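import Literature.MathematicalPhysics.QuantumFieldTheory.LatticeSiteRPMechanism
import Literature.MathematicalPhysics.QuantumFieldTheory.TorusLoopReflection
import HarnessLib

/-!
# The Cauchy–Schwarz inequality of abstract lattice reflection positivity

Theorem-only companion of `LatticeRPMechanism` / `LatticeSiteRPMechanism` (namespace
`Literature.MathematicalPhysics.QuantumFieldTheory.LatticeRP`; same objects: the product
probability measure `μ = piMeasure μ₀` on `Ω = ι → G`, the coordinate splice `splice C (U, Y)`,
a reflection `Θ`, a shared block `M`, coefficient functions `aᵢ`). The abstract
reflection-positivity theorem `integral_mul_conj_mul_exp_nonneg_of_shared` says that the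
sesquilinear form
`⟪g, g'⟫ = ∫∫ g(z) conj g'(ΘU) exp(∑ᵢ aᵢ(z) conj aᵢ(ΘU)) dμ(U) dμ(Y)`, `z = splice C (U, Y)`,
is positive semidefinite on bounded measurable functions depending only on the coordinates in
`P ∪ C ∪ M`. This file draws the consequence used for Wilson loops: for two finite families
`Φ = (Φₖ)`, `Ψ = (Ψₖ)` of such functions (the matrix entries of two staples),
`(Re ∑ₖ ⟪Φₖ, Ψₖ⟫)² ≤ (Re ∑ₖ ⟪Φₖ, Φₖ⟫) (Re ∑ₖ ⟪Ψₖ, Ψₖ⟫)` and `0 ≤ Re ∑ₖ ⟪Φₖ, Φₖ⟫`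
(`re_sum_pair_sq_le`), by expanding `∑ₖ ⟪Φₖ + t Ψₖ, Φₖ + t Ψₖ⟫ ≥ 0` for real and purely
imaginary `t` (`StringTension.re_sq_le_mul_of_nonneg_quadratic`). Everything here is proved.

## References

* K. Osterwalder, E. Seiler, Ann. Phys. 110 (1978) 440, §2; E. Seiler, LNP 159 (1982), §2
  (Schwarz inequality of the reflection-positive form applied to Wilson-loop staples).
-/

open MeasureTheory ProbabilityTheory Finset Filter
open scoped ComplexOrder ENNReal NNReal ComplexConjugate

namespace Literature.MathematicalPhysics.QuantumFieldTheory.LatticeRP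

noncomputable section

variable {ι : Type*} [Fintype ι] [DecidableEq ι] {G : Type*} [MeasurableSpace G]
variable (μ₀ : Measure G) [IsProbabilityMeasure μ₀]
variable (C : Finset ι) (Θ : (ι → G) → (ι → G)) {I : Type*} [Fintype I] (a : I → (ι → G) → ℂ)

/-! ## The pairing integrand and its integrability -/

omit [Fintype ι] [DecidableEq ι] [MeasurableSpace G] in
/-- Bound for the Gram kernel `exp(∑ᵢ aᵢ(z) conj aᵢ(w))`. [folklore] -/
theorem norm_exp_sum_le {Ka : ℝ} (hab : ∀ i U, ‖a i U‖ ≤ Ka) (z w : ι → G) :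
    ‖Complex.exp (∑ i, a i z * conj (a i w))‖ ≤ Real.exp (Fintype.card I * (Ka * Ka)) := by
  rw [Complex.norm_exp]
  refine Real.exp_le_exp.2 ((Complex.re_le_norm _).trans ?_)
  calc ‖∑ i, a i z * conj (a i w)‖ ≤ ∑ i, ‖a i z * conj (a i w)‖ := norm_sum_le _ _
    _ ≤ ∑ _i : I, Ka * Ka := Finset.sum_le_sum fun i _ => by
        rw [norm_mul, Complex.norm_conj]
        exact mul_le_mul (hab i z) (hab i w) (norm_nonneg _) ((norm_nonneg _).trans (hab i z))
    _ = Fintype.card I * (Ka * Ka) := by rw [Finset.sum_const, Finset.card_univ, nsmul_eq_mul]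

/-- **The pairing integrand is integrable** for bounded measurable `g, g'` and bounded
measurable coefficients. [folklore] -/
theorem integrable_pairIntegrand (hΘm : Measurable Θ) {g g' : (ι → G) → ℂ} (hgm : Measurable g)
    (hg'm : Measurable g') (ham : ∀ i, Measurable (a i)) {Kg Kg' Ka : ℝ} (hgb : ∀ U, ‖g U‖ ≤ Kg)
    (hg'b : ∀ U, ‖g' U‖ ≤ Kg') (hab : ∀ i U, ‖a i U‖ ≤ Ka) :
    Integrable (fun p : (ι → G) × (ι → G) => g (splice C p) * conj (g' (Θ p.1)) *
        Complex.exp (∑ i, a i (splice C p) * conj (a i (Θ p.1))))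
      ((piMeasure μ₀).prod (piMeasure μ₀)) := by
  have hconj : Measurable (starRingEnd ℂ : ℂ → ℂ) := Complex.continuous_conj.measurable
  have hsp : Measurable (splice (G := G) C) := measurable_splice C
  have hΘ1 : Measurable fun p : (ι → G) × (ι → G) => Θ p.1 := hΘm.comp measurable_fst
  refine integrable_of_norm_le (((hgm.comp hsp).mul (hconj.comp (hg'm.comp hΘ1))).mul
    (Complex.measurable_exp.comp (Finset.measurable_sum _ fun i _ =>
      ((ham i).comp hsp).mul (hconj.comp ((ham i).comp hΘ1)))))
    (K := Kg * Kg' * Real.exp (Fintype.card I * (Ka * Ka))) fun p => ?_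
  rw [norm_mul, norm_mul, Complex.norm_conj]
  have h1 : ‖g (splice C p)‖ * ‖g' (Θ p.1)‖ ≤ Kg * Kg' :=
    mul_le_mul (hgb _) (hg'b _) (norm_nonneg _) ((norm_nonneg _).trans (hgb (splice C p)))
  exact mul_le_mul h1 (norm_exp_sum_le a hab _ _) (norm_nonneg _)
    (mul_nonneg ((norm_nonneg _).trans (hgb (splice C p))) ((norm_nonneg _).trans (hg'b (Θ p.1))))

/-! ## Sesquilinear expansion on a two-dimensional span -/

/-- **Expansion of `⟪g + t g', g + t g'⟫`.** For bounded measurable `g, g'` and `t ∈ ℂ`,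
`⟪g + t g', g + t g'⟫ = ⟪g, g⟫ + conj t ⟪g, g'⟫ + t ⟪g', g⟫ + t conj t ⟪g', g'⟫` for the pairing
`⟪g, g'⟫ = ∫∫ g(z) conj g'(ΘU) exp(∑ᵢ aᵢ(z) conj aᵢ(ΘU))`. [folklore] -/
theorem integral_pair_add_smul (hΘm : Measurable Θ) {g g' : (ι → G) → ℂ} (hgm : Measurable g)
    (hg'm : Measurable g') (ham : ∀ i, Measurable (a i)) {Kg Kg' Ka : ℝ} (hgb : ∀ U, ‖g U‖ ≤ Kg)
    (hg'b : ∀ U, ‖g' U‖ ≤ Kg') (hab : ∀ i U, ‖a i U‖ ≤ Ka) (t : ℂ) :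
    ∫ p, (g (splice C p) + t * g' (splice C p)) * conj (g (Θ p.1) + t * g' (Θ p.1)) *
        Complex.exp (∑ i, a i (splice C p) * conj (a i (Θ p.1)))
      ∂((piMeasure μ₀).prod (piMeasure μ₀)) =
    (∫ p, g (splice C p) * conj (g (Θ p.1)) *
        Complex.exp (∑ i, a i (splice C p) * conj (a i (Θ p.1))) ∂((piMeasure μ₀).prod (piMeasure μ₀))) +
    conj t * (∫ p, g (splice C p) * conj (g' (Θ p.1)) *
        Complex.exp (∑ i, a i (splice C p) * conj (a i (Θ p.1))) ∂((piMeasure μ₀).prod (piMeasure μ₀))) +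
    t * (∫ p, g' (splice C p) * conj (g (Θ p.1)) *
        Complex.exp (∑ i, a i (splice C p) * conj (a i (Θ p.1))) ∂((piMeasure μ₀).prod (piMeasure μ₀))) +
    t * conj t * (∫ p, g' (splice C p) * conj (g' (Θ p.1)) *
        Complex.exp (∑ i, a i (splice C p) * conj (a i (Θ p.1))) ∂((piMeasure μ₀).prod (piMeasure μ₀))) := by
  have i11 := integrable_pairIntegrand μ₀ C Θ a hΘm hgm hgm ham hgb hgb hab
  have i12 := integrable_pairIntegrand μ₀ C Θ a hΘm hgm hg'm ham hgb hg'b hab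
  have i21 := integrable_pairIntegrand μ₀ C Θ a hΘm hg'm hgm ham hg'b hgb hab
  have i22 := integrable_pairIntegrand μ₀ C Θ a hΘm hg'm hg'm ham hg'b hg'b hab
  have key : (fun p : (ι → G) × (ι → G) => (g (splice C p) + t * g' (splice C p)) *
        conj (g (Θ p.1) + t * g' (Θ p.1)) * Complex.exp (∑ i, a i (splice C p) * conj (a i (Θ p.1)))) =
      fun p => (g (splice C p) * conj (g (Θ p.1)) * Complex.exp (∑ i, a i (splice C p) * conj (a i (Θ p.1))) +
        conj t * (g (splice C p) * conj (g' (Θ p.1)) *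
          Complex.exp (∑ i, a i (splice C p) * conj (a i (Θ p.1)))) +
        t * (g' (splice C p) * conj (g (Θ p.1)) *
          Complex.exp (∑ i, a i (splice C p) * conj (a i (Θ p.1))))) +
        t * conj t * (g' (splice C p) * conj (g' (Θ p.1)) *
          Complex.exp (∑ i, a i (splice C p) * conj (a i (Θ p.1)))) := by
    funext p
    simp only [map_add, map_mul]
    ring
  have i2 : Integrable (fun p : (ι → G) × (ι → G) =>
      g (splice C p) * conj (g (Θ p.1)) * Complex.exp (∑ i, a i (splice C p) * conj (a i (Θ p.1))) +
        conj t * (g (splice C p) * conj (g' (Θ p.1)) *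
          Complex.exp (∑ i, a i (splice C p) * conj (a i (Θ p.1)))))
      ((piMeasure μ₀).prod (piMeasure μ₀)) := i11.add (i12.const_mul _)
  have i3 : Integrable (fun p : (ι → G) × (ι → G) =>
      g (splice C p) * conj (g (Θ p.1)) * Complex.exp (∑ i, a i (splice C p) * conj (a i (Θ p.1))) +
        conj t * (g (splice C p) * conj (g' (Θ p.1)) *
          Complex.exp (∑ i, a i (splice C p) * conj (a i (Θ p.1)))) +
        t * (g' (splice C p) * conj (g (Θ p.1)) *
          Complex.exp (∑ i, a i (splice C p) * conj (a i (Θ p.1)))))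
      ((piMeasure μ₀).prod (piMeasure μ₀)) := i2.add (i21.const_mul _)
  rw [key, integral_add i3 (i22.const_mul _), integral_add i2 (i21.const_mul _),
    integral_add i11 (i12.const_mul _), integral_const_mul, integral_const_mul, integral_const_mul]

/-! ## The Cauchy–Schwarz inequality for families -/

variable (M P : Finset ι)

/-- **Cauchy–Schwarz for the reflection-positive form, family (matrix-entry) version.** In the
setting of the abstract reflection-positivity theorem with a shared block
(`integral_mul_conj_mul_exp_nonneg_of_shared`: `Θ` preserves `μ`, fixes the `M`-coordinates,
the `P ∪ C`-coordinates of `Θ U` depend only on `U` off `P`, `M` is disjoint from `P` and `C`,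
the coefficients `aᵢ` are bounded measurable and depend only on `P ∪ C ∪ M`), let
`Φ = (Φₖ)`, `Ψ = (Ψₖ)` be finite families of bounded measurable functions depending only on
`P ∪ C ∪ M`, and write `B(Φ, Ψ) = ∑ₖ ⟪Φₖ, Ψₖ⟫` with
`⟪g, g'⟫ = ∫∫ g(z) conj g'(ΘU) exp(∑ᵢ aᵢ(z) conj aᵢ(ΘU))`. Then `0 ≤ Re B(Φ, Φ)` and
`(Re B(Φ, Ψ))² ≤ Re B(Φ, Φ) · Re B(Ψ, Ψ)`. (Positivity of `B(Φ + tΨ, Φ + tΨ)` for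
`t ∈ ℝ ∪ iℝ` and the discriminant.) This is the Schwarz inequality by which reflection
positivity bounds a Wilson loop by the two symmetric loops (Seiler LNP 159 §2). [folklore] -/
theorem re_sum_pair_sq_le
    (hΘ : MeasurePreserving Θ (piMeasure μ₀) (piMeasure μ₀))
    (hΘM : ∀ U, ∀ i ∈ M, Θ U i = U i)
    (hΘdep : ∀ e ∈ P ∪ C, DependsOn (fun U => Θ U e) ((Pᶜ : Finset ι) : Set ι))
    (hMP : Disjoint M P) (hMC : Disjoint M C)
    (ham : ∀ i, Measurable (a i)) {Ka : ℝ} (hab : ∀ i U, ‖a i U‖ ≤ Ka)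
    (hadep : ∀ i, DependsOn (a i) ((P ∪ C ∪ M : Finset ι) : Set ι))
    {κ : Type*} [Fintype κ] {Φ Ψ : κ → (ι → G) → ℂ}
    (hΦm : ∀ k, Measurable (Φ k)) (hΨm : ∀ k, Measurable (Ψ k)) {KΦ KΨ : ℝ}
    (hΦb : ∀ k U, ‖Φ k U‖ ≤ KΦ) (hΨb : ∀ k U, ‖Ψ k U‖ ≤ KΨ)
    (hΦdep : ∀ k, DependsOn (Φ k) ((P ∪ C ∪ M : Finset ι) : Set ι))
    (hΨdep : ∀ k, DependsOn (Ψ k) ((P ∪ C ∪ M : Finset ι) : Set ι)) :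
    0 ≤ (∑ k, ∫ p, Φ k (splice C p) * conj (Φ k (Θ p.1)) *
        Complex.exp (∑ i, a i (splice C p) * conj (a i (Θ p.1)))
          ∂((piMeasure μ₀).prod (piMeasure μ₀))).re ∧
    (∑ k, ∫ p, Φ k (splice C p) * conj (Ψ k (Θ p.1)) *
        Complex.exp (∑ i, a i (splice C p) * conj (a i (Θ p.1)))
          ∂((piMeasure μ₀).prod (piMeasure μ₀))).re ^ 2 ≤
      (∑ k, ∫ p, Φ k (splice C p) * conj (Φ k (Θ p.1)) *
        Complex.exp (∑ i, a i (splice C p) * conj (a i (Θ p.1)))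
          ∂((piMeasure μ₀).prod (piMeasure μ₀))).re *
      (∑ k, ∫ p, Ψ k (splice C p) * conj (Ψ k (Θ p.1)) *
        Complex.exp (∑ i, a i (splice C p) * conj (a i (Θ p.1)))
          ∂((piMeasure μ₀).prod (piMeasure μ₀))).re := by
  have hΘm : Measurable Θ := hΘ.measurable
  -- the quadratic form on the span of `Φ` and `Ψ` is non-negative
  have hQ : ∀ t : ℂ, 0 ≤ ∑ k, ∫ p, (Φ k (splice C p) + t * Ψ k (splice C p)) *
      conj (Φ k (Θ p.1) + t * Ψ k (Θ p.1)) *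
      Complex.exp (∑ i, a i (splice C p) * conj (a i (Θ p.1)))
        ∂((piMeasure μ₀).prod (piMeasure μ₀)) := by
    intro t
    refine Finset.sum_nonneg fun k _ => ?_
    have hgm : Measurable fun U => Φ k U + t * Ψ k U := (hΦm k).add ((hΨm k).const_mul t)
    have hgb : ∀ U, ‖Φ k U + t * Ψ k U‖ ≤ KΦ + ‖t‖ * KΨ := fun U =>
      (norm_add_le _ _).trans (add_le_add (hΦb k U)
        (by rw [norm_mul]; exact mul_le_mul_of_nonneg_left (hΨb k U) (norm_nonneg _)))
    have hgdep : DependsOn (fun U => Φ k U + t * Ψ k U) ((P ∪ C ∪ M : Finset ι) : Set ι) :=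
      fun U V hUV => by simp only [hΦdep k hUV, hΨdep k hUV]
    exact integral_mul_conj_mul_exp_nonneg_of_shared μ₀ M P C Θ hΘ hΘM hΘdep hMP hMC hgm ham hgb
      hab hgdep hadep
  -- expand
  have hexp : ∀ t : ℂ, ∑ k, ∫ p, (Φ k (splice C p) + t * Ψ k (splice C p)) *
      conj (Φ k (Θ p.1) + t * Ψ k (Θ p.1)) *
      Complex.exp (∑ i, a i (splice C p) * conj (a i (Θ p.1)))
        ∂((piMeasure μ₀).prod (piMeasure μ₀)) =
    (∑ k, ∫ p, Φ k (splice C p) * conj (Φ k (Θ p.1)) *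
        Complex.exp (∑ i, a i (splice C p) * conj (a i (Θ p.1))) ∂((piMeasure μ₀).prod (piMeasure μ₀))) +
    conj t * (∑ k, ∫ p, Φ k (splice C p) * conj (Ψ k (Θ p.1)) *
        Complex.exp (∑ i, a i (splice C p) * conj (a i (Θ p.1))) ∂((piMeasure μ₀).prod (piMeasure μ₀))) +
    t * (∑ k, ∫ p, Ψ k (splice C p) * conj (Φ k (Θ p.1)) *
        Complex.exp (∑ i, a i (splice C p) * conj (a i (Θ p.1))) ∂((piMeasure μ₀).prod (piMeasure μ₀))) +
    t * conj t * (∑ k, ∫ p, Ψ k (splice C p) * conj (Ψ k (Θ p.1)) *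
        Complex.exp (∑ i, a i (splice C p) * conj (a i (Θ p.1))) ∂((piMeasure μ₀).prod (piMeasure μ₀))) := by
    intro t
    simp_rw [integral_pair_add_smul μ₀ C Θ a hΘm (hΦm _) (hΨm _) ham (hΦb _) (hΨb _) hab t,
      Finset.sum_add_distrib, Finset.mul_sum]
  -- abbreviate the four Gram entries
  set A := ∑ k, ∫ p, Φ k (splice C p) * conj (Φ k (Θ p.1)) *
        Complex.exp (∑ i, a i (splice C p) * conj (a i (Θ p.1))) ∂((piMeasure μ₀).prod (piMeasure μ₀))
  set B := ∑ k, ∫ p, Φ k (splice C p) * conj (Ψ k (Θ p.1)) *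
        Complex.exp (∑ i, a i (splice C p) * conj (a i (Θ p.1))) ∂((piMeasure μ₀).prod (piMeasure μ₀))
  set B' := ∑ k, ∫ p, Ψ k (splice C p) * conj (Φ k (Θ p.1)) *
        Complex.exp (∑ i, a i (splice C p) * conj (a i (Θ p.1))) ∂((piMeasure μ₀).prod (piMeasure μ₀))
  set E := ∑ k, ∫ p, Ψ k (splice C p) * conj (Ψ k (Θ p.1)) *
        Complex.exp (∑ i, a i (splice C p) * conj (a i (Θ p.1))) ∂((piMeasure μ₀).prod (piMeasure μ₀))
  have h0 : 0 ≤ A := by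
    have := hQ 0
    rw [hexp 0] at this
    simpa using this
  refine ⟨(Complex.nonneg_iff.1 h0).1, ?_⟩
  refine Literature.MathematicalPhysics.QuantumFieldTheory.StringTension.re_sq_le_mul_of_nonneg_quadratic
    (a := A) (b := B) (c := B') (e := E) (fun s => ?_) (fun u => ?_)
  · have := hQ (s : ℂ)
    rw [hexp] at this
    simp only [Complex.conj_ofReal] at this
    convert this using 1
    ring
  · have := hQ (Complex.I * (u : ℂ))
    rw [hexp] at this
    simp only [map_mul, Complex.conj_I, Complex.conj_ofReal] at this
    convert this using 1
    have hI : Complex.I * Complex.I = -1 := Complex.I_mul_I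
    linear_combination (u : ℂ) ^ 2 * E * hI

end

end Literature.MathematicalPhysics.QuantumFieldTheory.LatticeRP
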